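import Mathlib

/-!
# Route `AnisotropyChord` / H0 rotor rung, K_{n,n} sibling of XY-LM₀: generic JACOBI-MATRIX toolkit
(prover seat `hubbard-h0-rotor-p1` g13; serves the Lean port of theory seat `hubbard-h0-rotor-theory-1`'s THEOREMS M12–M14,
memo ROTOR-THEORY-11 §163/§166; director ruling CYCLE 12 (B))

A real symmetric tridiagonal («Jacobi») matrix `jac m p c` on `Fin m` with diagonal `p k` and coupling `c k` between the
levels `k` and `k+1`; its row and quadratic-form formulas through the zero-extension `ext0` of a vector to `ℕ`; the
variational top vector `IsTopVector` (non-zero, entrywise non-negative maximiser of the Rayleigh quotient, as typed by the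
theory seat in `PartKnn.lean`) is an eigenvector (`mulVec_eq_smul_of_isTopVector`), and for positive couplings it is
entrywise positive and unique up to scale.  Pure linear algebra; no physics here.
-/

set_option linter.dupNamespace false
set_option autoImplicit false

noncomputable section

open Finset Matrix

namespace Summit.HubbardSuperconductivity.HubbardSuperconductivity.Theorems.AnisotropyChord.Knn

/-! ## Vectors on `Fin m` extended by zero to `ℕ` -/

/-- Zero-extension of `y : Fin m → ℝ` to `ℕ` (`ext0 y k = y k` for `k < m`, `0` beyond). [folklore] -/
def ext0 {m : ℕ} (y : Fin m → ℝ) : ℕ → ℝ := fun k => if h : k < m then y ⟨k, h⟩ else 0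

/-- `ext0 y k = y ⟨k, _⟩` inside the range. [folklore] -/
theorem ext0_of_lt {m : ℕ} (y : Fin m → ℝ) {k : ℕ} (hk : k < m) : ext0 y k = y ⟨k, hk⟩ := by
  simp [ext0, hk]

/-- `ext0 y k = y k` on `Fin m`. [folklore] -/
@[simp] theorem ext0_fin {m : ℕ} (y : Fin m → ℝ) (k : Fin m) : ext0 y k = y k := by
  simp [ext0, k.isLt]

/-- `ext0 y k = 0` outside the range. [folklore] -/
theorem ext0_of_le {m : ℕ} (y : Fin m → ℝ) {k : ℕ} (hk : m ≤ k) : ext0 y k = 0 := by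
  simp [ext0, not_lt.mpr hk]

/-- `ext0 y m = 0`. [folklore] -/
@[simp] theorem ext0_self {m : ℕ} (y : Fin m → ℝ) : ext0 y m = 0 := ext0_of_le y le_rfl

/-- A sum over `Fin m` is the range sum of the zero-extension. [folklore] -/
theorem sum_fin_eq_sum_range_ext0 {m : ℕ} (y : Fin m → ℝ) (g : ℕ → ℝ) :
    ∑ k : Fin m, g k * y k = ∑ k ∈ range m, g k * ext0 y k := by
  rw [← Fin.sum_univ_eq_sum_range (fun k => g k * ext0 y k) m]
  simp
/-! ## The Jacobi matrix -/
/-- The symmetric tridiagonal (Jacobi) matrix on `Fin m` with diagonal `p` and coupling `c k` between `k` and `k+1`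
(same branch structure as the theory seat's `knnBlock`). [folklore] -/
def jac (m : ℕ) (p c : ℕ → ℝ) : Matrix (Fin m) (Fin m) ℝ := fun k l =>
  if k = l then p k else if l.val = k.val + 1 then c k else if k.val = l.val + 1 then c l else 0

/-- `jac` is symmetric. [folklore] -/
theorem jac_isSymm (m : ℕ) (p c : ℕ → ℝ) : (jac m p c).IsSymm := by
  ext k l
  simp only [jac, transpose_apply]
  by_cases h : k = l
  · subst h; simp
  · have h' : ¬ l = k := fun e => h e.symm
    simp only [h, h', if_false]
    split_ifs <;> first | rfl | omega

/-- entry formula as a sum of three exclusive indicators. [folklore] -/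
theorem jac_apply_eq (m : ℕ) (p c : ℕ → ℝ) (k l : Fin m) :
    jac m p c k l = (if k.val = l.val then p k else 0) + (if l.val = k.val + 1 then c k else 0)
      + (if k.val = l.val + 1 then c l else 0) := by
  simp only [jac, Fin.ext_iff]
  split_ifs <;> first | (exfalso; omega) | simp

/-- **Row formula:** `(P y)_k = p_k y_k + c_k y_{k+1} + c_{k−1} y_{k−1}` (boundary terms vanish). [folklore] -/
theorem jac_mulVec_apply (m : ℕ) (p c : ℕ → ℝ) (y : Fin m → ℝ) (k : Fin m) :
    (jac m p c *ᵥ y) k = p k * ext0 y k + c k * ext0 y (k + 1)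
      + (if k.val = 0 then 0 else c (k - 1) * ext0 y (k - 1)) := by
  have hk := k.isLt
  simp only [mulVec, dotProduct]
  set F : ℕ → ℝ := fun j => (if k.val = j then p k else 0) + (if j = k.val + 1 then c k else 0)
          + (if k.val = j + 1 then c j else 0) with hF
  have : ∀ l : Fin m, jac m p c k l * y l = F l * y l := by
    intro l; simp only [jac_apply_eq, hF]
  rw [Finset.sum_congr rfl (fun l _ => this l), sum_fin_eq_sum_range_ext0]
  simp only [hF, add_mul, sum_add_distrib]
  have e1 : ∑ j ∈ range m, (if k.val = j then p k else 0) * ext0 y j = p k * ext0 y k := by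
    rw [Finset.sum_eq_single k.val]
    · simp
    · intro j _ hj; simp [Ne.symm hj]
    · intro h; exact absurd (mem_range.mpr hk) h
  have e2 : ∑ j ∈ range m, (if j = k.val + 1 then c k else 0) * ext0 y j = c k * ext0 y (k + 1) := by
    by_cases h1 : k.val + 1 < m
    · rw [Finset.sum_eq_single (k.val + 1)]
      · simp
      · intro j _ hj; simp [hj]
      · intro h; exact absurd (mem_range.mpr h1) h
    · rw [ext0_of_le y (not_lt.mp h1), mul_zero]
      apply Finset.sum_eq_zero
      intro j hj
      have : j ≠ k.val + 1 := by
        intro e; rw [e] at hj; exact h1 (mem_range.mp hj)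
      simp [this]
  have e3 : ∑ j ∈ range m, (if k.val = j + 1 then c j else 0) * ext0 y j
      = (if k.val = 0 then 0 else c (k - 1) * ext0 y (k - 1)) := by
    by_cases h0 : k.val = 0
    · simp [h0]
    · rw [if_neg h0, Finset.sum_eq_single (k.val - 1)]
      · have : k.val = k.val - 1 + 1 := by omega
        simp [← this]
      · intro j _ hj
        have : ¬ k.val = j + 1 := by omega
        simp [this]
      · intro h; exfalso; exact h (mem_range.mpr (by omega))
  rw [e1, e2, e3]

/-- **Quadratic form:** `y·P y = Σ_{k<m} (p_k y_k² + 2 c_k y_k y_{k+1})`. [folklore] -/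
theorem jac_quadForm (m : ℕ) (p c : ℕ → ℝ) (y : Fin m → ℝ) :
    y ⬝ᵥ (jac m p c *ᵥ y) = ∑ k ∈ range m, (p k * ext0 y k ^ 2 + 2 * c k * ext0 y k * ext0 y (k + 1)) := by
  simp only [dotProduct]
  set G : ℕ → ℝ := fun j => p j * ext0 y j + c j * ext0 y (j + 1)
          + (if j = 0 then 0 else c (j - 1) * ext0 y (j - 1)) with hG
  have : ∀ k : Fin m, y k * (jac m p c *ᵥ y) k = G k * y k := by
    intro k; simp only [jac_mulVec_apply, hG]; ring
  rw [Finset.sum_congr rfl (fun k _ => this k), sum_fin_eq_sum_range_ext0]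
  have hGy : ∀ j : ℕ, G j * ext0 y j = ext0 y j * (p j * ext0 y j + c j * ext0 y (j + 1)
      + (if j = 0 then 0 else c (j - 1) * ext0 y (j - 1))) := by
    intro j; simp only [hG]; ring
  rw [Finset.sum_congr rfl (fun j _ => hGy j)]
  -- the backward coupling sum equals the forward one
  have hback : ∑ j ∈ range m, ext0 y j * (if j = 0 then 0 else c (j - 1) * ext0 y (j - 1))
      = ∑ j ∈ range m, c j * ext0 y j * ext0 y (j + 1) := by
    cases m with
    | zero => simp
    | succ n =>
      rw [Finset.sum_range_succ' (fun j => ext0 y j * _), Finset.sum_range_succ]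
      simp only [if_true, mul_zero, add_zero, Nat.succ_ne_zero, if_false, Nat.add_sub_cancel,
        ext0_self, mul_zero, add_zero]
      apply Finset.sum_congr rfl
      intro j _; ring
  have hsplit : ∀ j : ℕ, ext0 y j * (p j * ext0 y j + c j * ext0 y (j + 1)
      + (if j = 0 then 0 else c (j - 1) * ext0 y (j - 1)))
      = (p j * ext0 y j ^ 2 + c j * ext0 y j * ext0 y (j + 1))
        + ext0 y j * (if j = 0 then 0 else c (j - 1) * ext0 y (j - 1)) := by
    intro j; ring
  rw [Finset.sum_congr rfl (fun j _ => hsplit j), sum_add_distrib, hback, ← sum_add_distrib]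
  apply Finset.sum_congr rfl
  intro j _; ring

/-! ## The variational top vector (theory seat's `IsTopVector`) -/
/-- **Top (Perron) vector, variationally** — VERBATIM port of the theory seat's `IsTopVector` (PartKnn.lean, cycle 12):
a non-zero, entrywise non-negative maximiser of the Rayleigh quotient, written cross-multiplied. [folklore] -/
def IsTopVector {m : ℕ} (A : Matrix (Fin m) (Fin m) ℝ) (x : Fin m → ℝ) : Prop :=
  x ≠ 0 ∧ (∀ i, 0 ≤ x i) ∧ ∀ y : Fin m → ℝ, (y ⬝ᵥ A.mulVec y) * (x ⬝ᵥ x) ≤ (x ⬝ᵥ A.mulVec x) * (y ⬝ᵥ y)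

/-- The Rayleigh quotient `⟨x, A x⟩/⟨x, x⟩`. [folklore] -/
def rayleigh {m : ℕ} (A : Matrix (Fin m) (Fin m) ℝ) (x : Fin m → ℝ) : ℝ := (x ⬝ᵥ A *ᵥ x) / (x ⬝ᵥ x)

/-- `⟨x,x⟩ > 0` for `x ≠ 0`. [folklore] -/
theorem dotProduct_self_pos_of_ne_zero {m : ℕ} {x : Fin m → ℝ} (hx : x ≠ 0) : 0 < x ⬝ᵥ x := by
  have h0 : 0 ≤ x ⬝ᵥ x := by
    simp only [dotProduct]; exact Finset.sum_nonneg fun i _ => mul_self_nonneg (x i)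
  rcases h0.lt_or_eq with h | h
  · exact h
  · exfalso; apply hx
    have h' : ∑ i, x i * x i = 0 := by simpa [dotProduct] using h.symm
    rw [Finset.sum_eq_zero_iff_of_nonneg (fun i _ => mul_self_nonneg (x i))] at h'
    funext i
    exact mul_self_eq_zero.mp (h' i (Finset.mem_univ i))

/-- For a symmetric matrix, `⟨x, A z⟩ = ⟨z, A x⟩`. [folklore] -/
theorem dotProduct_mulVec_symm {m : ℕ} {A : Matrix (Fin m) (Fin m) ℝ} (hA : A.IsSymm)
    (x z : Fin m → ℝ) : x ⬝ᵥ A *ᵥ z = z ⬝ᵥ A *ᵥ x := by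
  rw [dotProduct_mulVec, ← mulVec_transpose, hA.eq, dotProduct_comm]

/-- A top vector attains the maximal Rayleigh quotient: `⟨y, A y⟩ ≤ rayleigh(x)·⟨y, y⟩`. [folklore] -/
theorem quadForm_le_rayleigh_mul {m : ℕ} {A : Matrix (Fin m) (Fin m) ℝ} {x : Fin m → ℝ}
    (hx : IsTopVector A x) (y : Fin m → ℝ) : y ⬝ᵥ A *ᵥ y ≤ rayleigh A x * (y ⬝ᵥ y) := by
  have hxx := dotProduct_self_pos_of_ne_zero hx.1
  have h := hx.2.2 y
  rw [rayleigh, div_mul_eq_mul_div, le_div_iff₀ hxx]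
  linarith

/-- `⟨x, A x⟩ = rayleigh(x)·⟨x,x⟩`. [folklore] -/
theorem quadForm_eq_rayleigh_mul {m : ℕ} (A : Matrix (Fin m) (Fin m) ℝ) {x : Fin m → ℝ} (hx : x ≠ 0) :
    x ⬝ᵥ A *ᵥ x = rayleigh A x * (x ⬝ᵥ x) := by
  have hxx := dotProduct_self_pos_of_ne_zero hx
  rw [rayleigh, div_mul_cancel₀ _ hxx.ne']

/-- Two top vectors have the same Rayleigh quotient. [folklore] -/
theorem rayleigh_eq_of_isTopVector {m : ℕ} {A : Matrix (Fin m) (Fin m) ℝ} {x x' : Fin m → ℝ}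
    (hx : IsTopVector A x) (hx' : IsTopVector A x') : rayleigh A x = rayleigh A x' := by
  have h1 := hx.2.2 x'
  have h2 := hx'.2.2 x
  have hxx := dotProduct_self_pos_of_ne_zero hx.1
  have hxx' := dotProduct_self_pos_of_ne_zero hx'.1
  rw [rayleigh, rayleigh, div_eq_div_iff hxx.ne' hxx'.ne']
  linarith

/-- **A variational top vector of a symmetric matrix is an eigenvector** (`A x = rayleigh(x)·x`): the first variation of
the Rayleigh quotient at a maximiser vanishes. [folklore] -/
theorem mulVec_eq_smul_of_isTopVector {m : ℕ} {A : Matrix (Fin m) (Fin m) ℝ} (hA : A.IsSymm)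
    {x : Fin m → ℝ} (hx : IsTopVector A x) : A *ᵥ x = rayleigh A x • x := by
  have hxx := dotProduct_self_pos_of_ne_zero hx.1
  set qx := x ⬝ᵥ A *ᵥ x with hqx
  set nx := x ⬝ᵥ x with hnx
  -- first variation: β(z) := ⟨z, A x⟩·nx − qx·⟨x, z⟩ vanishes for every z
  have hvar : ∀ z : Fin m → ℝ, (z ⬝ᵥ A *ᵥ x) * nx - qx * (x ⬝ᵥ z) = 0 := by
    intro z
    set β := (z ⬝ᵥ A *ᵥ x) * nx - qx * (x ⬝ᵥ z) with hβ
    set α := (z ⬝ᵥ A *ᵥ z) * nx - qx * (z ⬝ᵥ z) with hα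
    -- the inequality for y = x + t z reads 2βt + αt² ≤ 0
    have hineq : ∀ t : ℝ, 2 * β * t + α * t ^ 2 ≤ 0 := by
      intro t
      have h := hx.2.2 (x + t • z)
      have e1 : (x + t • z) ⬝ᵥ A *ᵥ (x + t • z)
          = qx + 2 * t * (z ⬝ᵥ A *ᵥ x) + t ^ 2 * (z ⬝ᵥ A *ᵥ z) := by
        rw [mulVec_add, mulVec_smul, add_dotProduct, dotProduct_add, dotProduct_add, smul_dotProduct,
          smul_dotProduct, dotProduct_smul, dotProduct_smul, dotProduct_mulVec_symm hA x z]
        simp only [smul_eq_mul]; ring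
      have e2 : (x + t • z) ⬝ᵥ (x + t • z) = nx + 2 * t * (x ⬝ᵥ z) + t ^ 2 * (z ⬝ᵥ z) := by
        rw [add_dotProduct, dotProduct_add, dotProduct_add, smul_dotProduct, smul_dotProduct, dotProduct_smul,
          dotProduct_smul, dotProduct_comm z x]
        simp only [smul_eq_mul]; ring
      rw [e1, e2] at h
      have : (qx + 2 * t * (z ⬝ᵥ A *ᵥ x) + t ^ 2 * (z ⬝ᵥ A *ᵥ z)) * nx
          - qx * (nx + 2 * t * (x ⬝ᵥ z) + t ^ 2 * (z ⬝ᵥ z)) = 2 * β * t + α * t ^ 2 := by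
        rw [hβ, hα]; ring
      linarith
    -- choose t = β/(|α|+1)
    have hpos : 0 < |α| + 1 := by positivity
    have h := hineq (β / (|α| + 1))
    have h' : β ^ 2 * (2 * (|α| + 1) + α) ≤ 0 := by
      have e : (2 * β * (β / (|α| + 1)) + α * (β / (|α| + 1)) ^ 2) * (|α| + 1) ^ 2
          = β ^ 2 * (2 * (|α| + 1) + α) := by
        field_simp
      rw [← e]
      exact mul_nonpos_of_nonpos_of_nonneg h (by positivity)
    have hcoef : 0 < 2 * (|α| + 1) + α := by
      have := neg_abs_le α; linarith
    have hβ2 : β ^ 2 ≤ 0 := by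
      by_contra hcon
      have := mul_pos (not_le.mp hcon) hcoef
      linarith
    have : β ^ 2 = 0 := le_antisymm hβ2 (sq_nonneg β)
    exact pow_eq_zero_iff (two_ne_zero) |>.mp this
  -- hence nx·A x − qx·x is orthogonal to everything, so it vanishes
  have hzero : nx • (A *ᵥ x) - qx • x = 0 := by
    set w := nx • (A *ᵥ x) - qx • x with hw
    have hw0 : w ⬝ᵥ w = 0 := by
      have e : w ⬝ᵥ w = (w ⬝ᵥ A *ᵥ x) * nx - qx * (x ⬝ᵥ w) := by
        conv_lhs => rw [hw]
        rw [dotProduct_sub, dotProduct_smul, dotProduct_smul, smul_eq_mul, smul_eq_mul, dotProduct_comm w x]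
        ring
      rw [e]; exact hvar w
    by_contra hne
    exact (dotProduct_self_pos_of_ne_zero hne).ne' hw0
  have : nx • (A *ᵥ x) = qx • x := sub_eq_zero.mp hzero
  calc A *ᵥ x = nx⁻¹ • (nx • (A *ᵥ x)) := by rw [smul_smul, inv_mul_cancel₀ hxx.ne', one_smul]
    _ = nx⁻¹ • (qx • x) := by rw [this]
    _ = rayleigh A x • x := by rw [smul_smul, rayleigh, hqx, hnx, div_eq_inv_mul]

/-- Componentwise eigen-equation of a top vector of a Jacobi matrix:
`λ x_k = p_k x_k + c_k x_{k+1} + c_{k−1} x_{k−1}`. [folklore] -/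
theorem eigen_row_of_isTopVector {m : ℕ} {p c : ℕ → ℝ} {x : Fin m → ℝ} (hx : IsTopVector (jac m p c) x)
    (k : Fin m) :
    rayleigh (jac m p c) x * ext0 x k = p k * ext0 x k + c k * ext0 x (k + 1)
      + (if k.val = 0 then 0 else c (k - 1) * ext0 x (k - 1)) := by
  have h := mulVec_eq_smul_of_isTopVector (jac_isSymm m p c) hx
  have hk := congrFun h k
  rw [jac_mulVec_apply, Pi.smul_apply, smul_eq_mul, ← ext0_fin x k] at hk
  linarith
/-! ## Perron facts for positive couplings: positivity and uniqueness of the top vector -/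
/-- `ext0` of a top vector is entrywise non-negative on all of `ℕ`. [folklore] -/
theorem ext0_nonneg_of_isTopVector {m : ℕ} {A : Matrix (Fin m) (Fin m) ℝ} {x : Fin m → ℝ}
    (hx : IsTopVector A x) (k : ℕ) : 0 ≤ ext0 x k := by
  unfold ext0; split_ifs with h
  · exact hx.2.1 _
  · exact le_rfl

/-- **Perron positivity:** for positive couplings a top vector of a Jacobi matrix is entrywise positive
(a zero entry propagates to its neighbours through the eigen-equation). [folklore] -/
theorem isTopVector_pos {m : ℕ} {p c : ℕ → ℝ} (hc : ∀ k, k + 1 < m → 0 < c k) {x : Fin m → ℝ}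
    (hx : IsTopVector (jac m p c) x) (k : Fin m) : 0 < x k := by
  have hnn := ext0_nonneg_of_isTopVector hx
  set lam := rayleigh (jac m p c) x
  -- the eigen-rows in `ℕ`-indexed form
  have hrow : ∀ j : ℕ, j < m → lam * ext0 x j = p j * ext0 x j + c j * ext0 x (j + 1)
      + (if j = 0 then 0 else c (j - 1) * ext0 x (j - 1)) := fun j hj =>
    eigen_row_of_isTopVector hx ⟨j, hj⟩
  by_contra hneg
  have hk0 : ext0 x k = 0 := by
    rw [ext0_fin]; exact le_antisymm (not_lt.mp hneg) (hx.2.1 k)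
  -- a zero entry forces zero neighbours
  have hprop : ∀ j : ℕ, j < m → ext0 x j = 0 →
      (j + 1 < m → ext0 x (j + 1) = 0) ∧ (0 < j → ext0 x (j - 1) = 0) := by
    intro j hj hz
    have h := hrow j hj
    rw [hz, mul_zero, mul_zero, zero_add] at h
    have h1 : 0 ≤ c j * ext0 x (j + 1) := by
      by_cases hj1 : j + 1 < m
      · exact mul_nonneg (hc j hj1).le (hnn _)
      · rw [ext0_of_le x (not_lt.mp hj1), mul_zero]
    have h2 : 0 ≤ (if j = 0 then 0 else c (j - 1) * ext0 x (j - 1)) := by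
      split_ifs with hj0
      · exact le_rfl
      · exact mul_nonneg (hc (j - 1) (by omega)).le (hnn _)
    have e1 : c j * ext0 x (j + 1) = 0 := by linarith
    have e2 : (if j = 0 then 0 else c (j - 1) * ext0 x (j - 1)) = 0 := by linarith
    constructor
    · intro hj1
      rcases mul_eq_zero.mp e1 with h | h
      · exact absurd h (hc j hj1).ne'
      · exact h
    · intro hj0
      rw [if_neg (Nat.pos_iff_ne_zero.mp hj0)] at e2
      rcases mul_eq_zero.mp e2 with h | h
      · exact absurd h (hc (j - 1) (by omega)).ne'
      · exact h
  -- descend to index 0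
  have hdown : ∀ d : ℕ, d ≤ k.val → ext0 x (k.val - d) = 0 := by
    intro d
    induction d with
    | zero => intro _; simpa using hk0
    | succ d ih =>
      intro hd
      have h := (hprop (k.val - d) (by omega) (ih (by omega))).2 (by omega)
      have e : k.val - d - 1 = k.val - (d + 1) := by omega
      rw [e] at h; exact h
  have h0 : ext0 x 0 = 0 := by simpa using hdown k.val le_rfl
  -- ascend to every index
  have hup : ∀ j : ℕ, j < m → ext0 x j = 0 := by
    intro j
    induction j with
    | zero => intro _; exact h0
    | succ j ih => intro hj; exact (hprop j (by omega) (ih (by omega))).1 hj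
  apply hx.1
  funext i
  have := hup i.val i.isLt
  rw [ext0_fin] at this
  simpa using this

/-- **Perron uniqueness:** two top vectors of a Jacobi matrix with positive couplings are positive multiples of each
other (both solve the same second-order recursion from the bottom level). [folklore] -/
theorem isTopVector_unique {m : ℕ} {p c : ℕ → ℝ} (hc : ∀ k, k + 1 < m → 0 < c k) {x x' : Fin m → ℝ}
    (hx : IsTopVector (jac m p c) x) (hx' : IsTopVector (jac m p c) x') :
    ∃ t : ℝ, 0 < t ∧ x' = t • x := by
  rcases Nat.eq_zero_or_pos m with hm | hm
  · subst hm; exact absurd (funext fun i => Fin.elim0 i) hx.1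
  have hlam : rayleigh (jac m p c) x' = rayleigh (jac m p c) x := rayleigh_eq_of_isTopVector hx' hx
  set lam := rayleigh (jac m p c) x
  have hrow : ∀ j : ℕ, j < m → lam * ext0 x j = p j * ext0 x j + c j * ext0 x (j + 1)
      + (if j = 0 then 0 else c (j - 1) * ext0 x (j - 1)) := fun j hj =>
    eigen_row_of_isTopVector hx ⟨j, hj⟩
  have hrow' : ∀ j : ℕ, j < m → lam * ext0 x' j = p j * ext0 x' j + c j * ext0 x' (j + 1)
      + (if j = 0 then 0 else c (j - 1) * ext0 x' (j - 1)) := fun j hj => by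
    rw [← hlam]; exact eigen_row_of_isTopVector hx' ⟨j, hj⟩
  have hx0 : 0 < ext0 x 0 := by rw [ext0_of_lt x hm]; exact isTopVector_pos hc hx ⟨0, hm⟩
  have hx0' : 0 < ext0 x' 0 := by rw [ext0_of_lt x' hm]; exact isTopVector_pos hc hx' ⟨0, hm⟩
  set t := ext0 x' 0 / ext0 x 0 with ht
  have htpos : 0 < t := div_pos hx0' hx0
  -- two-step induction along the recursion
  have hind : ∀ j : ℕ, ext0 x' j = t * ext0 x j ∧ ext0 x' (j + 1) = t * ext0 x (j + 1) := by
    intro j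
    induction j with
    | zero =>
      refine ⟨by rw [ht, div_mul_cancel₀ _ hx0.ne'], ?_⟩
      by_cases h1 : 1 < m
      · have r := hrow 0 hm
        have r' := hrow' 0 hm
        simp only [if_true, add_zero, zero_add] at r r'
        have hc0 := hc 0 (by omega)
        have e : c 0 * ext0 x' 1 = c 0 * (t * ext0 x 1) := by
          have : ext0 x' 0 = t * ext0 x 0 := by rw [ht, div_mul_cancel₀ _ hx0.ne']
          rw [this] at r'
          nlinarith [r, r']
        exact mul_left_cancel₀ hc0.ne' e
      · rw [ext0_of_le x' (by omega), ext0_of_le x (by omega), mul_zero]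
    | succ j ih =>
      refine ⟨ih.2, ?_⟩
      by_cases hj2 : j + 2 < m
      · have r := hrow (j + 1) (by omega)
        have r' := hrow' (j + 1) (by omega)
        simp only [Nat.succ_ne_zero, if_false, Nat.add_sub_cancel] at r r'
        rw [ih.1, ih.2] at r'
        have hc1 := hc (j + 1) hj2
        have e : c (j + 1) * ext0 x' (j + 1 + 1) = c (j + 1) * (t * ext0 x (j + 1 + 1)) := by
          nlinarith [r, r']
        exact mul_left_cancel₀ hc1.ne' e
      · rw [ext0_of_le x' (by omega), ext0_of_le x (by omega), mul_zero]
  refine ⟨t, htpos, funext fun i => ?_⟩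
  have := (hind i.val).1
  rw [ext0_fin, ext0_fin] at this
  simpa using this

end Summit.HubbardSuperconductivity.HubbardSuperconductivity.Theorems.AnisotropyChord.Knn
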